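import Mathlib
import HarnessLib

/-!
# The concavity of `σ₂^{1/2}` on the cone `Γ₂⁺` as a reverse Cauchy–Schwarz inequality

Support file for the named fact
`Literature.Geometry.Riemannian.gurskyViaclovsky_hessianEstimate_weighted_four`
(Gursky–Viaclovsky 2003, Prop. 6: the `C²` estimate along the `σ₂`-continuity path, whose proof
rests on "the main fact … that `σ₂^{1/2}(A^t)` is a concave function of the second derivative
variables, which follows easily from the inequality (convexity)", i.e. from their Prop. 1 (iii):
`{σ₂((1−s)A + sB)}^{1/2} ≥ (1−s){σ₂(A)}^{1/2} + s{σ₂(B)}^{1/2}` for `A, B ∈ Γ₂⁺`, with the proof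
pointer "standard, and may be found in [CNSIII] and [Garding]").

Since `2σ₂(A) = σ₁(A)² − |A|²`, the function `2σ₂` is a quadratic form of Lorentzian type
`Q(Y) = c ℓ(Y)² − ⟨Y, Y⟩` (`ℓ = σ₁` linear, `⟨·,·⟩` positive semidefinite, `c = 1`; for the twisted
operator `σ₂(λ + s σ₁(λ) e)` of the path, `c = 1 + 6s(1+2s)`), and the concavity of `√Q` on the
future cone `{Q > 0, ℓ > 0}` is Gårding's inequality for hyperbolic quadratic forms, i.e. the
**reverse Cauchy–Schwarz inequality** `Q(Y) Q(W) ≤ B(W, Y)²` (`B` the polarisation of `Q`, `W`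
timelike, `Y` arbitrary). This file proves it in that abstract form, over any real vector space:

* `sq_le_mul_self_of_nonneg` — Cauchy–Schwarz `⟨X,Y⟩² ≤ ⟨X,X⟩⟨Y,Y⟩` for a symmetric positive
  semidefinite bilinear form (discriminant);
* `reverse_cauchy_schwarz` — **for `Q(W) = cℓ(W)² − ⟨W,W⟩ > 0` (`c > 0`) and every `Y`,
  `(cℓ(Y)² − ⟨Y,Y⟩)(cℓ(W)² − ⟨W,W⟩) ≤ (cℓ(W)ℓ(Y) − ⟨W,Y⟩)²`** (the vector `Q(W)Y − B(W,Y)W` is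
  `B(W,·)`-orthogonal to `W`, hence `Q`-nonpositive by Cauchy–Schwarz);
* `sqrt_mul_le` — **Gursky–Viaclovsky's Prop. 1 (iii) in polarised form**: for `W`, `Y` in the
  closed future cone (`W` in the open one), `√(Q(Y)Q(W)) ≤ cℓ(W)ℓ(Y) − ⟨W,Y⟩`, i.e.
  `2σ₂(A)^{1/2}σ₂(B)^{1/2} ≤ σ₁(A)σ₁(B) − ⟨A,B⟩`, which is the supporting-hyperplane form of the
  concavity of `σ₂^{1/2}` on `Γ₂⁺` (`σ₂^{1/2}(B) ≤ ⟨∇σ₂^{1/2}(A), B⟩`);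
* `sq_sum_sum_mul_le` — the frame inequality `(Σᵢⱼ vᵢvⱼWᵢⱼ)² ≤ (ΣᵢⱼWᵢⱼ²)(Σᵢvᵢ²)²` (operator norm
  against the Hilbert–Schmidt norm), behind Prop. 1 (ii): `σ₁(A)δ − A ≥ (σ₁(A) − |A|)δ > 0` on
  `Γ₂⁺` (the first Newton transformation is positive definite).

Everything is proved; no definition and no named fact is introduced.

## References

* M. J. Gursky, J. A. Viaclovsky, *A fully nonlinear equation on four-manifolds with positive
  scalar curvature*, J. Differential Geom. 63 (2003) 131–154, §2, Prop. 1 (ii)–(iii) and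
  (convexity); §5, proof of Prop. 6. [GurskyViaclovsky2003]
* S. Chen, *Local estimates for some fully nonlinear elliptic equations*, IMRN 2005:63, §1,
  (S1)–(S2) and the lemma following them. [Chen2005]
-/

namespace Literature.Geometry.Riemannian.Sigma2Cone

variable {V : Type*} [AddCommGroup V] [Module ℝ V]

/-- **Cauchy–Schwarz for a positive semidefinite symmetric bilinear form** on a real vector space:
`⟨X,Y⟩² ≤ ⟨X,X⟩⟨Y,Y⟩` (the discriminant of `t ↦ ⟨X + tY, X + tY⟩ ≥ 0`). [folklore] -/
theorem sq_le_mul_self_of_nonneg (ip : V →ₗ[ℝ] V →ₗ[ℝ] ℝ) (hsymm : ∀ X Y, ip X Y = ip Y X)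
    (hpos : ∀ X, 0 ≤ ip X X) (X Y : V) : ip X Y ^ 2 ≤ ip X X * ip Y Y := by
  have h : ∀ t : ℝ, 0 ≤ ip Y Y * (t * t) + 2 * ip X Y * t + ip X X := by
    intro t
    have h1 := hpos (X + t • Y)
    simp only [map_add, map_smul, LinearMap.add_apply, LinearMap.smul_apply, smul_eq_mul] at h1
    rw [hsymm Y X] at h1
    nlinarith [h1]
  have hd := discrim_le_zero h
  rw [discrim] at hd
  nlinarith [hd]

/-- **The reverse Cauchy–Schwarz inequality for a form of Lorentzian type** (Gårding's inequality
behind Gursky–Viaclovsky 2003, Prop. 1 (iii)). Let `⟨·,·⟩` be a symmetric positive semidefinite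
bilinear form and `ℓ` a linear form on a real vector space, `c > 0`, `Q(Y) = cℓ(Y)² − ⟨Y,Y⟩` with
polarisation `B(W,Y) = cℓ(W)ℓ(Y) − ⟨W,Y⟩`. If `Q(W) > 0` then `Q(Y)Q(W) ≤ B(W,Y)²` for every `Y`.
Proof: `Y' = Q(W)Y − B(W,Y)W` satisfies `B(W,Y') = 0`, so `c²ℓ(W)²ℓ(Y')² = ⟨W,Y'⟩² ≤ ⟨W,W⟩⟨Y',Y'⟩
≤ cℓ(W)²⟨Y',Y'⟩`, whence `Q(Y') ≤ 0`; and `Q(Y') = Q(W)(Q(W)Q(Y) − B(W,Y)²)`.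
[cite: GurskyViaclovsky2003, Prop. 1 (iii)] -/
theorem reverse_cauchy_schwarz (ip : V →ₗ[ℝ] V →ₗ[ℝ] ℝ) (hsymm : ∀ X Y, ip X Y = ip Y X)
    (hpos : ∀ X, 0 ≤ ip X X) (ℓ : V →ₗ[ℝ] ℝ) {c : ℝ} (hc : 0 < c)
    {W : V} (hW : ip W W < c * ℓ W ^ 2) (Y : V) :
    (c * ℓ Y ^ 2 - ip Y Y) * (c * ℓ W ^ 2 - ip W W) ≤ (c * (ℓ W * ℓ Y) - ip W Y) ^ 2 := by
  set QW : ℝ := c * ℓ W ^ 2 - ip W W with hQW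
  set B : ℝ := c * (ℓ W * ℓ Y) - ip W Y with hB
  have hQW0 : 0 < QW := by rw [hQW]; linarith
  -- the vector `Y'' = QW • Y − B • W` is `B(W, ·)`-orthogonal to `W`
  set Y' : V := QW • Y - B • W with hY'
  have hℓ : ℓ Y' = QW * ℓ Y - B * ℓ W := by
    simp only [hY', map_sub, map_smul, smul_eq_mul]
  have hWY' : ip W Y' = QW * ip W Y - B * ip W W := by
    simp only [hY', map_sub, map_smul, smul_eq_mul]
  have hY'Y' : ip Y' Y' = QW ^ 2 * ip Y Y - 2 * (QW * B) * ip W Y + B ^ 2 * ip W W := by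
    simp only [hY', map_sub, map_smul, LinearMap.sub_apply, LinearMap.smul_apply, smul_eq_mul]
    rw [hsymm Y W]
    ring
  have horth : c * (ℓ W * ℓ Y') = ip W Y' := by
    rw [hℓ, hWY', hB, hQW]
    ring
  -- `Q(Y') ≤ 0`: Cauchy–Schwarz `(ip W Y')² ≤ ip W W · ip Y' Y'` and `ip W W < c ℓ(W)²`
  have hCS := sq_le_mul_self_of_nonneg ip hsymm hpos W Y'
  have hℓW : 0 < ℓ W ^ 2 := by
    by_contra h
    have h0 : ℓ W ^ 2 = 0 := le_antisymm (not_lt.1 h) (sq_nonneg _)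
    rw [h0, mul_zero] at hW
    exact (not_lt.2 (hpos W)) hW
  have hQY' : c * ℓ Y' ^ 2 ≤ ip Y' Y' := by
    -- `c² ℓW² ℓY'² = (ip W Y')² ≤ ip W W · ip Y'Y' ≤ c ℓW² · ip Y'Y'`
    have h1 : c ^ 2 * ℓ W ^ 2 * ℓ Y' ^ 2 ≤ c * ℓ W ^ 2 * ip Y' Y' := by
      have h2 : (ip W Y') ^ 2 = c ^ 2 * ℓ W ^ 2 * ℓ Y' ^ 2 := by rw [← horth]; ring
      have h3 : ip W W * ip Y' Y' ≤ c * ℓ W ^ 2 * ip Y' Y' :=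
        mul_le_mul_of_nonneg_right hW.le (hpos Y')
      linarith
    have hcl : 0 < c * ℓ W ^ 2 := mul_pos hc hℓW
    have h4 : c * ℓ W ^ 2 * (c * ℓ Y' ^ 2) ≤ c * ℓ W ^ 2 * ip Y' Y' := by nlinarith
    exact le_of_mul_le_mul_left h4 hcl
  -- `Q(Y') = QW (QW Q(Y) − B²)`
  have hexp : c * ℓ Y' ^ 2 - ip Y' Y' = QW * (QW * (c * ℓ Y ^ 2 - ip Y Y) - B ^ 2) := by
    rw [hℓ, hY'Y', hB, hQW]
    ring
  have h5 : QW * (QW * (c * ℓ Y ^ 2 - ip Y Y) - B ^ 2) ≤ 0 := by rw [← hexp]; linarith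
  have h6 : QW * (c * ℓ Y ^ 2 - ip Y Y) - B ^ 2 ≤ 0 := by
    by_contra h
    exact absurd h5 (not_le.2 (mul_pos hQW0 (not_le.1 h)))
  rw [hQW, hB] at h6
  linarith

/-- **Gursky–Viaclovsky 2003, Prop. 1 (iii), polarised**: for `W` in the open and `Y` in the
closed future cone of `Q = cℓ² − ⟨·,·⟩` (`Q(W) > 0`, `Q(Y) ≥ 0`, `ℓ(W), ℓ(Y) ≥ 0`),
`√(Q(Y)Q(W)) ≤ B(W,Y) = cℓ(W)ℓ(Y) − ⟨W,Y⟩`. With `c = 1`, `ℓ = σ₁`, `⟨·,·⟩` the trace form on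
symmetric matrices this reads `2σ₂(A)^{1/2}σ₂(B)^{1/2} ≤ σ₁(A)σ₁(B) − tr(AB)`, the
supporting-hyperplane inequality `σ₂^{1/2}(B) ≤ ⟨∇σ₂^{1/2}(A), B⟩` expressing the concavity of the
degree-one homogeneous function `σ₂^{1/2}` on `Γ₂⁺` (the source's (convexity)).
[cite: GurskyViaclovsky2003, Prop. 1 (iii)] -/
theorem sqrt_mul_le (ip : V →ₗ[ℝ] V →ₗ[ℝ] ℝ) (hsymm : ∀ X Y, ip X Y = ip Y X)
    (hpos : ∀ X, 0 ≤ ip X X) (ℓ : V →ₗ[ℝ] ℝ) {c : ℝ} (hc : 0 < c)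
    {W Y : V} (hW : ip W W < c * ℓ W ^ 2) (hY : ip Y Y ≤ c * ℓ Y ^ 2)
    (hℓW : 0 ≤ ℓ W) (hℓY : 0 ≤ ℓ Y) :
    Real.sqrt ((c * ℓ Y ^ 2 - ip Y Y) * (c * ℓ W ^ 2 - ip W W)) ≤ c * (ℓ W * ℓ Y) - ip W Y := by
  have hB : 0 ≤ c * (ℓ W * ℓ Y) - ip W Y := by
    -- `ip W Y ≤ √(ip W W) √(ip Y Y) ≤ c ℓW ℓY`
    have hCS := sq_le_mul_self_of_nonneg ip hsymm hpos W Y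
    have h1 : ip W Y ^ 2 ≤ (c * (ℓ W * ℓ Y)) ^ 2 := by
      calc ip W Y ^ 2 ≤ ip W W * ip Y Y := hCS
        _ ≤ (c * ℓ W ^ 2) * (c * ℓ Y ^ 2) := mul_le_mul hW.le hY (hpos Y) (by positivity)
        _ = (c * (ℓ W * ℓ Y)) ^ 2 := by ring
    have h2 : 0 ≤ c * (ℓ W * ℓ Y) := by positivity
    have h3 : |ip W Y| ≤ c * (ℓ W * ℓ Y) := by
      rw [← Real.sqrt_sq h2, ← Real.sqrt_sq_eq_abs]
      exact Real.sqrt_le_sqrt h1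
    linarith [le_abs_self (ip W Y)]
  calc Real.sqrt ((c * ℓ Y ^ 2 - ip Y Y) * (c * ℓ W ^ 2 - ip W W))
      ≤ Real.sqrt ((c * (ℓ W * ℓ Y) - ip W Y) ^ 2) :=
        Real.sqrt_le_sqrt (reverse_cauchy_schwarz ip hsymm hpos ℓ hc hW Y)
    _ = c * (ℓ W * ℓ Y) - ip W Y := Real.sqrt_sq hB

/-- **A symmetric array is dominated by its Hilbert–Schmidt norm**:
`(Σᵢⱼ vᵢ vⱼ Wᵢⱼ)² ≤ (Σᵢⱼ Wᵢⱼ²)(Σᵢ vᵢ²)²` (Cauchy–Schwarz on `Fin n × Fin n`). On the cone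
`Γ₂⁺ = {σ₁ > 0, σ₂ > 0}` one has `|A|² = σ₁² − 2σ₂ < σ₁²`, so this gives
`A(v,v) < σ₁(A)|v|²`, i.e. the first Newton transformation `T₁(A) = σ₁(A)δ − A` is positive definite
(Gursky–Viaclovsky 2003, Prop. 1 (ii)). [cite: GurskyViaclovsky2003, Prop. 1 (ii)] -/
theorem sq_sum_sum_mul_le {n : ℕ} (W : Fin n → Fin n → ℝ) (v : Fin n → ℝ) :
    (∑ i, ∑ j, v i * v j * W i j) ^ 2 ≤ (∑ i, ∑ j, W i j ^ 2) * (∑ i, v i ^ 2) ^ 2 := by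
  have h1 : ∑ i, ∑ j, v i * v j * W i j = ∑ p ∈ Finset.univ ×ˢ Finset.univ, (v p.1 * v p.2) * W p.1 p.2 := by
    rw [Finset.sum_product]
  have h2 : ∑ i, ∑ j, W i j ^ 2 = ∑ p ∈ Finset.univ ×ˢ Finset.univ, W p.1 p.2 ^ 2 := by
    rw [Finset.sum_product]
  have h3 : (∑ i, v i ^ 2) ^ 2 = ∑ p ∈ Finset.univ ×ˢ Finset.univ, (v p.1 * v p.2) ^ 2 := by
    rw [Finset.sum_product, sq, Finset.sum_mul_sum]
    refine Finset.sum_congr rfl fun i _ ↦ Finset.sum_congr rfl fun j _ ↦ ?_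
    ring
  rw [h1, h2, h3, mul_comm]
  exact Finset.sum_mul_sq_le_sq_mul_sq _ _ _

end Literature.Geometry.Riemannian.Sigma2Cone
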